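import Literature.NumberTheory.GelbartRogawski1991.FiniteAdelicWeilCentralCoinvariants
import Literature.RepresentationTheory.TwistedCoinvariantsIrreducible
import HarnessLib

/-!
# `Coinv(⊗'_v ω_v ∘ Πʳφ, ∏χ_v)` is IRREDUCIBLE when the local quotients are irreducible admissible (Flath)

Topic `NumberTheory/GelbartRogawski1991`.  Theorems only (no definition, no record, no named fact, no `sorry`).
Continuation of `FiniteAdelicWeilCentralCoinvariants.lean` (`FinLocalSplittings.omegaPi_centralCoinv`: for a family
`𝓢` of LOCAL splittings `s_v : U(J)(F_v) →* S̃p_{ψ_v}(𝕎_v)` the coinvariants of the place-assembled finite Weil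
representation `Ω = 𝓢.OmegaPi = ⊗'_v ω_v` under a central restricted sub-family `Πʳφ` at `χ = ∏_v χ_v` ARE
`⊗'_v Coinv(ω_v ∘ φ_v, χ_v)` as representations of `Πʳ_v [U(J)(F_v), U(J)(𝒪_v)]`) by Flath's theorem (easy direction;
the tree's `RestrictedTensorProductIrreducibleProofs.lean`):

* §1 `IsRestrictedTensorProductRep.isIrreducible_of_isAdmissible` — Flath's theorem with EXACTLY the hypotheses its
  tree proof uses: over an algebraically closed field a restricted tensor product of irreducible admissible
  representations of topological groups `G_v` (multiplication separately continuous) w.r.t. compact open `K_v` is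
  irreducible.  (The tree's `IsRestrictedTensorProductRep.isIrreducible_holds` discharges the NAMED FACT
  `….isIrreducible`, whose statement also binds `NonarchimedeanGroup`/`LocallyCompactSpace`/`T2Space` instances and the
  spherical clause `hsph`; its proof uses none of them — «the spherical hypothesis is only needed for admissibility» —
  and is repeated here verbatim under the weaker binders, so that the Weil carriers below, whose unramified local
  quotients are not asserted spherical, can use it.)
* §2 `finiteAdeleRep_centralCoinv_isIrreducible` — for the tree's place-assembled `finiteAdeleRep K ι r hK = ⊗'_v r_v`
  on `𝒮((𝔸_{K,f})^ι)` and a central restricted sub-family `φ_v : H_v →* G_v`: if every local quotient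
  `Coinv(r_v ∘ φ_v, χ_v)` is an irreducible admissible `G_v`-representation and the unramified vector survives off a
  finite set (`[1_{𝒪_v^ι}] ≠ 0`, `hx₀N`), then `Coinv(⊗'_v r_v ∘ Πʳφ, ∏χ_v)` is an irreducible representation of
  `Πʳ_v [G_v, K_v]` (`finiteAdeleRep_centralCoinv` + `exists_centralCoinvMap` + §1).
* §3 `FinLocalSplittings.omegaPi_centralCoinv_isIrreducible` — the unitary instance: `Coinv(Ω ∘ Πʳφ, χ)` with its
  `Πʳ_v [U(J)(F_v), U(J)(𝒪_v)]`-action `TwistedCoinv.rep χ 𝓢.OmegaPi hcomm` is irreducible as soon as every local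
  quotient `Coinv(ω_v ∘ φ_v, χ_v)` is irreducible and admissible under `U(J)(F_v)` and `[1_{𝒪_vᴺ}] ≠ 0` off `S₁`
  (`U(J)(𝒪_v)` is compact open: `isOpen_localInt`, `isCompact_localInt`); `….omega_centralCoinv_isIrreducible` — the
  same read on `U(J)(𝔸_{F,f})` through `finAdelicEquiv` (`𝓢.Omega = 𝓢.OmegaPi ∘ finAdelicEquiv`) and with the acting
  group `Πʳ_v [H_v, KH_v]` replaced by any group `W` mapping ONTO it (`TwistedCoinvariantsIrreducible.lean`).

With `φ_v` the local centre `E_v¹ ↪ U(V)(F_v)` this is the sentence of [Liu2021, Def. 4.11 (`FJcycle.tex` l. 2092–2096)]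
— the adèlic oscillator representation `ω(μ, ε, χ) := ⊗'_v ω(μ_v, ε_v, χ_v)`, «which is an irreducible admissible
representation» — REDUCED, in the kernel, to its two printed local inputs: [Liu2021, App. D Lem. D.1, first sentence
(l. 5227)] «Then `ω(μ, ε, χ)` is irreducible and admissible» (LOCAL notation of App. D: at the place `v` this is
`ω(μ_v, ε_v, χ_v)`) at every finite place (hypotheses `hirr`, `hadm` below, stated on the tree's local carriers
`TwistedCoinv.rep (χ_v) (ω_v)`) and the survival of the unramified vector for almost all `v` (`hx₀N`, Def. 4.11 «unramified
for all but finitely many `v`»).  Nothing of [Liu2021] is asserted; HC_CM is not mentioned by this file.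

## References
* [Flath1979] D. Flath, *Decomposition of representations into tensor products*, PSPM 33 (1979) part 1, Thm. 2, Ex. 2.
* [Bump1997] D. Bump, *Automorphic forms and representations* (1997), Prop. 3.4.9, Thm. 3.4.4, Prop. 4.2.4.
* [Liu2021] Y. Liu, Camb. J. Math. 9 (2021) = arXiv:2102.11518: Def. 4.11 (l. 2083–2097), App. D §D.1 Steps 1∕2∕3
  (l. 5217∕5219∕5221), Lem. D.1 (l. 5227; (1) l. 5229 for non-vanishing).
* [GelbartRogawski1991] S. Gelbart, J. Rogawski, Invent. Math. 105 (1991), §3.1 Prop. 3.1.1 p. 455.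
-/

noncomputable section

open scoped RestrictedProduct TensorProduct
open Filter Function Set IsDedekindDomain NumberField Module PiTensorProduct
open Literature.RepresentationTheory

/-! ### §1 Flath's theorem (easy direction) under exactly the hypotheses its proof uses -/

namespace Literature.NumberTheory.Automorphic

universe u uk uG uH v w

section Flath

variable {ι : Type u} {k : Type uk} [Field k] {G : ι → Type uG} [∀ i, Group (G i)]
  {K : ∀ i, Subgroup (G i)} {V : ι → Type v} [∀ i, AddCommGroup (V i)] [∀ i, Module k (V i)]
  {ρ : ∀ i, Representation k (G i) (V i)} {x₀ : ∀ i, V i} [DecidableEq ι]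
  {W : Type w} [AddCommGroup W] [Module k W] {π : Representation k (Πʳ i, [G i, K i]) W}
  {hx₀ : ∀ᶠ i in cofinite, x₀ i ∈ (ρ i).fixedPoints (K i)}
  {j : RestrictedFamily V x₀ → W} {S₀ : Finset ι} [∀ i, TopologicalSpace (G i)]

/-- **Flath's theorem, easy direction, with the hypotheses its proof uses**: over an algebraically closed field, a
restricted tensor product `(W, π, j) = ⊗'_i (ρ_i, x₀_i)` of IRREDUCIBLE ADMISSIBLE representations `ρ_i` of topological
groups `G_i` (multiplication separately continuous) with respect to compact open subgroups `K_i` is an irreducible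
representation of `Πʳ i, [G i, K i]`.  Proof = the tree's `IsRestrictedTensorProductRep.isIrreducible_holds` verbatim
(Schur for admissible irreducibles `Representation.IsAdmissible.exists_eq_smul_id`, Jacobson density
`Representation.exists_asAlgebraHom_apply_eq`, finite tensor products `piTensorProduct_submodule_eq_top`, directed union of
the `range (liftFinset S)`), minus the unused binders (`NonarchimedeanGroup`, `LocallyCompactSpace`, `T2Space`, the
spherical clause `hsph`). [cite: Flath1979, Theorem 2 / Example 2] -/
theorem IsRestrictedTensorProductRep.isIrreducible_of_isAdmissible [IsAlgClosed k]
    [∀ i, SeparatelyContinuousMul (G i)]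
    (hK : ∀ i, IsOpen (K i : Set (G i))) (hKc : ∀ i, IsCompact (K i : Set (G i)))
    (hirr : ∀ i, (ρ i).IsIrreducible) (hρ : ∀ i, (ρ i).IsAdmissible)
    (h : IsRestrictedTensorProductRep ρ π hx₀ j S₀) : π.IsIrreducible := by
  obtain ⟨hj, hinj, hsup⟩ := h.isRestrictedTensorProduct
  have hequiv := h.map_smul
  -- Jacobson density for each (irreducible, admissible ⇒ scalar commutant) factor
  have hd : ∀ (i : ι) (s : Finset (V i)) (f : V i →ₗ[k] V i),
      ∃ r : MonoidAlgebra k (G i), ∀ m ∈ s, (ρ i).asAlgebraHom r m = f m := fun i =>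
    haveI := hirr i
    Representation.exists_asAlgebraHom_apply_eq
      fun T hT => (hρ i).exists_eq_smul_id (hK i) (hKc i) T hT
  haveI hVnt : ∀ i, Nontrivial (V i) := fun i =>
    haveI := hirr i
    Representation.IsIrreducible.nontrivial (ρ i)
  -- `W ≠ 0`: `liftFinset S₀` is injective on the non-zero `⨂_{i ∈ S₀} V i`
  haveI : Nontrivial W :=
    haveI : Nontrivial (⨂[k] i : S₀, V i) := piTensorProduct_nontrivial
    (hinj S₀ subset_rfl).nontrivial
  have hmono : Monotone fun S : Finset ι => LinearMap.range (hj.liftFinset S) :=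
    hj.monotone_range_liftFinset
  have hmem : ∀ w : W, ∃ S : Finset ι, w ∈ LinearMap.range (hj.liftFinset S) := fun w =>
    (Submodule.mem_iSup_of_directed _ hmono.directed_le).1 (by rw [hsup]; exact Submodule.mem_top)
  refine { toNontrivial := ⟨⟨⊥, ⊤, fun hbt => ?_⟩⟩, eq_bot_or_eq_top := fun U => ?_ }
  · exact bot_ne_top (congrArg Subrepresentation.toSubmodule hbt)
  by_cases hU : U = ⊥
  · exact Or.inl hU
  refine Or.inr (Subrepresentation.toSubmodule_injective (Submodule.eq_top_iff'.2 fun w => ?_))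
  have hU' : U.toSubmodule ≠ ⊥ := fun h' => hU (Subrepresentation.toSubmodule_injective h')
  obtain ⟨u, huU, hu0⟩ := Submodule.exists_mem_ne_zero_of_ne_bot hU'
  obtain ⟨S₁, hu⟩ := hmem u
  obtain ⟨S₂, hw⟩ := hmem w
  obtain ⟨S, hS₁, hS₂⟩ : ∃ S : Finset ι, S₁ ⊆ S ∧ S₂ ⊆ S :=
    ⟨S₁ ∪ S₂, Finset.subset_union_left, Finset.subset_union_right⟩
  obtain ⟨t₀, rfl⟩ : u ∈ LinearMap.range (hj.liftFinset S) := hmono hS₁ hu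
  obtain ⟨t₁, rfl⟩ : w ∈ LinearMap.range (hj.liftFinset S) := hmono hS₂ hw
  -- the preimage of `U` in `⨂_{i ∈ S} V i` is stable under `∏_{i ∈ S} G i` and non-zero
  let U' : Submodule k (⨂[k] i : S, V i) := U.toSubmodule.comap (hj.liftFinset S)
  have hstab : ∀ (g : ∀ i : S, G i), ∀ t ∈ U', map (fun i : S => ρ i (g i)) t ∈ U' := by
    intro g t ht
    let g' : Πʳ i, [G i, K i] :=
      RestrictedProduct.mk (fun i => if hi : i ∈ S then g ⟨i, hi⟩ else 1)
        (S.eventually_cofinite_notMem.mono fun i hi => by simp [hi])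
    have hg' : (fun i : S => ρ i (g i)) = fun i : S => ρ i (g' i) := by
      funext i
      change ρ i (g i) = ρ i (if hi : (i : ι) ∈ S then g ⟨i, hi⟩ else 1)
      rw [dif_pos i.2]
    have hg'' : ∀ i ∉ S, ρ i (g' i) (x₀ i) = x₀ i := fun i hi => by
      change ρ i (if hi : (i : ι) ∈ S then g ⟨i, hi⟩ else 1) (x₀ i) = x₀ i
      rw [dif_neg hi, map_one, Module.End.one_apply]
    change hj.liftFinset S (map (fun i : S => ρ i (g i)) t) ∈ U.toSubmodule
    rw [hg', hj.liftFinset_map_eq hequiv S g' hg'' t]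
    exact U.apply_mem_toSubmodule g' ht
  have hU'0 : U' ≠ ⊥ := by
    intro hbot
    have ht₀ : t₀ ∈ U' := huU
    rw [hbot, Submodule.mem_bot] at ht₀
    exact hu0 (by rw [ht₀, map_zero])
  have hU'top : U' = ⊤ :=
    piTensorProduct_submodule_eq_top (fun i : S => ρ i) (fun i => hd i) hstab hU'0
  have ht₁ : t₁ ∈ U' := hU'top ▸ Submodule.mem_top
  exact ht₁

end Flath

/-! ### §2 The place-assembled finite-adelic representation: irreducible central coinvariants -/

section Weil

variable (K : Type) [Field K] [NumberField K] (ι : Type) [Fintype ι] [DecidableEq (HeightOneSpectrum (𝓞 K))]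
  {G : HeightOneSpectrum (𝓞 K) → Type uG} [∀ v, Group (G v)] {Kc : ∀ v, Subgroup (G v)}
  (r : ∀ v, Representation ℂ (G v) ↥(SchwartzBruhat (ι → v.adicCompletion K)))
  (hK : ∀ᶠ v in cofinite, unitVec K ι v ∈ (r v).fixedPoints (Kc v))
  {H : HeightOneSpectrum (𝓞 K) → Type uH} [∀ v, Group (H v)] {KH : ∀ v, Subgroup (H v)}
  (φ : ∀ v, H v →* G v) (hφ : ∀ᶠ v in cofinite, MapsTo (φ v) (KH v) (Kc v))
  {χloc : ∀ v, H v →* ℂˣ}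
  [∀ v, TopologicalSpace (G v)] [∀ v, SeparatelyContinuousMul (G v)]

/-- **`Coinv(⊗'_v r_v ∘ Πʳφ, ∏χ_v)` is irreducible** as a representation of `Πʳ_v [G_v, K_v]` whenever the `K_v` are
compact open, every local quotient `Coinv(r_v ∘ φ_v, χ_v)` with its `G_v`-action `TwistedCoinv.rep (χ_v) (r_v)` is
irreducible and admissible, and the class of the unramified vector `[1_{𝒪_v^ι}]` is non-zero off a finite set `S₁`:
the coinvariants are `⊗'_v` of the local quotients (`finiteAdeleRep_centralCoinv`, comparison map from
`exists_centralCoinvMap`), and Flath's theorem applies (§1). [cite: Flath1979, Theorem 2 / Example 2; Liu2021, Def. 4.11 (l. 2092–2096)] -/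
theorem finiteAdeleRep_centralCoinv_isIrreducible
    (hKo : ∀ v, IsOpen (Kc v : Set (G v))) (hKcc : ∀ v, IsCompact (Kc v : Set (G v)))
    (hc : ∀ (v : HeightOneSpectrum (𝓞 K)) (g : G v) (h' : H v),
      Commute (r v g) ((show Representation ℂ (H v) _ from (r v).comp (φ v)) h'))
    (hcomm : ∀ (g : Πʳ v, [G v, Kc v]) (h' : Πʳ v, [H v, KH v]),
      Commute (finiteAdeleRep K ι r hK g)
        (((finiteAdeleRep K ι r hK).comp (RestrictedProduct.mapAlongMonoidHom H G id Filter.tendsto_id φ hφ)) h'))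
    (χ : (Πʳ v, [H v, KH v]) →* ℂˣ)
    (hχ : ∀ g : Πʳ v, [H v, KH v], ((χ g : ℂˣ) : ℂ) = ∏ᶠ v, ((χloc v (g v) : ℂˣ) : ℂ))
    (hχK : ∀ᶠ v in cofinite, ∀ g ∈ KH v, χloc v g = 1)
    {S₁ : Finset (HeightOneSpectrum (𝓞 K))}
    (hx₀N : ∀ v ∉ S₁,
      TwistedCoinv.mk (show Representation ℂ (H v) _ from (r v).comp (φ v)) (χloc v) (unitVec K ι v) ≠ 0)
    (hirr : ∀ v, (TwistedCoinv.rep (χloc v) (r v) (hc v)).IsIrreducible)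
    (hadm : ∀ v, (TwistedCoinv.rep (χloc v) (r v) (hc v)).IsAdmissible) :
    (TwistedCoinv.rep χ (finiteAdeleRep K ι r hK) hcomm).IsIrreducible := by
  obtain ⟨J, hJ⟩ := (isRestrictedTensorProductRep_finiteAdeleRep K ι r hK).exists_centralCoinvMap
    (φ := φ) (hφ := hφ) (χloc := χloc) (hq := Filter.Eventually.of_forall fun _ => rfl) χ hχ
  exact IsRestrictedTensorProductRep.isIrreducible_of_isAdmissible hKo hKcc hirr hadm
    (finiteAdeleRep_centralCoinv K ι r hK φ hφ hc hcomm χ hχ hχK hx₀N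
      (IsRestrictedTensorProductRep.eventually_mk_mem_fixedPoints hc hK) J hJ)

end Weil

end Literature.NumberTheory.Automorphic

/-! ### §3 The finite Weil representation of a unitary group assembled from local splittings -/

namespace Literature.NumberTheory.GelbartRogawski1991.UnitaryDualPair.LocalSplitting.FinLocalSplittings

open scoped Classical
open Literature.NumberTheory.Automorphic

universe uH

variable {F : Type} [Field F] [NumberField F] {E : Type} [Field E] [NumberField E] [Algebra F E]
  [Algebra.IsQuadraticExtension F E] {c : E ≃ₐ[F] E} {N : ℕ} {δ : E} {hcδ : c δ = -δ} {hδ : δ ≠ 0} {d : F}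
  {hd : δ * δ = algebraMap F E d} {T : Matrix (Fin N) (Fin N) F} {hT : T.IsSymm}
  {J : Matrix (Fin N) (Fin N) E} {hJ : J = T.map (algebraMap F E)}
  (𝓢 : FinLocalSplittings F E c N hcδ hδ hd T hT hJ)
  {H : HeightOneSpectrum (𝓞 F) → Type uH} [∀ v, Group (H v)] {KH : ∀ v, Subgroup (H v)}
  (φ : ∀ v, H v →* UnitaryGroup.localPi E c N J v)
  (hφ : ∀ᶠ v in cofinite, MapsTo (φ v) (KH v) (UnitaryGroup.localInt E c N J v))
  {χloc : ∀ v, H v →* ℂˣ}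

/-- **[Liu2021, Def. 4.11]'s «irreducible» reduced to its local inputs, on the tree's Weil carrier.**  For a family
of local splittings `𝓢` (`s_v : U(J)(F_v) →* S̃p_{ψ_v}(𝕎_v)`, Liu's `ι_{μ_v}`), a central restricted sub-family
`φ_v : H_v →* U(J)(F_v)` (`hc`, `hcomm`: automatic for `φ_v` of central image, e.g. the local centre `E_v¹`), local
characters `χ_v` trivial on `KH_v` almost everywhere and `χ = ∏_v χ_v`: if EVERY local maximal `χ_v`-quotient
`Coinv(ω_v ∘ φ_v, χ_v)` is an irreducible admissible representation of `U(J)(F_v)` ([Liu2021, App. D Lem. D.1, first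
sentence l. 5227] «`ω(μ, ε, χ)` is irreducible and admissible», App. D's local notation, read at the place `v`) and the
unramified vector survives off a finite set `S₁` (`[1_{𝒪_vᴺ}] ≠ 0`), then the
coinvariants `Coinv(Ω ∘ Πʳφ, χ)` of `Ω = ⊗'_v ω_v` — «the maximal quotient on which
`Πʳ_v H_v` acts by `χ`» — form an IRREDUCIBLE representation of `Πʳ_v [U(J)(F_v), U(J)(𝒪_v)]`
(`omegaPi_centralCoinv` + Flath; `U(J)(𝒪_v)` compact open by `isOpen_localInt` / `isCompact_localInt`).
[cite: Liu2021, Def. 4.11 (l. 2092–2096), App. D Lem. D.1 (l. 5227; (1) l. 5229 for non-vanishing); Flath1979, Theorem 2 / Example 2] -/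
theorem omegaPi_centralCoinv_isIrreducible
    (hc : ∀ (v : HeightOneSpectrum (𝓞 F)) (g : UnitaryGroup.localPi E c N J v) (h' : H v),
      Commute (𝓢.omegaLoc v g) ((show Representation ℂ (H v) _ from (𝓢.omegaLoc v).comp (φ v)) h'))
    (hcomm : ∀ (g : Πʳ v : HeightOneSpectrum (𝓞 F), [UnitaryGroup.localPi E c N J v, UnitaryGroup.localInt E c N J v])
        (h' : Πʳ v, [H v, KH v]),
      Commute (𝓢.OmegaPi g)
        ((𝓢.OmegaPi.comp (RestrictedProduct.mapAlongMonoidHom H (fun v => UnitaryGroup.localPi E c N J v) id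
          Filter.tendsto_id φ hφ)) h'))
    (χ : (Πʳ v, [H v, KH v]) →* ℂˣ)
    (hχ : ∀ g : Πʳ v, [H v, KH v], ((χ g : ℂˣ) : ℂ) = ∏ᶠ v, ((χloc v (g v) : ℂˣ) : ℂ))
    (hχK : ∀ᶠ v in cofinite, ∀ g ∈ KH v, χloc v g = 1)
    {S₁ : Finset (HeightOneSpectrum (𝓞 F))}
    (hx₀N : ∀ v ∉ S₁,
      TwistedCoinv.mk (show Representation ℂ (H v) _ from (𝓢.omegaLoc v).comp (φ v)) (χloc v) (unitVec F (Fin N) v)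
        ≠ 0)
    (hirr : ∀ v, (TwistedCoinv.rep (χloc v) (𝓢.omegaLoc v) (hc v)).IsIrreducible)
    (hadm : ∀ v, (TwistedCoinv.rep (χloc v) (𝓢.omegaLoc v) (hc v)).IsAdmissible) :
    (TwistedCoinv.rep χ 𝓢.OmegaPi hcomm).IsIrreducible :=
  finiteAdeleRep_centralCoinv_isIrreducible F (Fin N) 𝓢.omegaLoc 𝓢.unitVec_mem_fixedPoints φ hφ
    (fun v => UnitaryGroup.isOpen_localInt E c N J v) (fun v => UnitaryGroup.isCompact_localInt E c N J v) hc hcomm χ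
    hχ hχK hx₀N hirr hadm

/-- **The same read on `U(J)(𝔸_{F,f})` and on any group `W` mapping onto `Πʳ_v [H_v, KH_v]`.**  With
`Ω = 𝓢.Omega = 𝓢.OmegaPi ∘ finAdelicEquiv` (a topological group isomorphism `U(J)(𝔸_{F,f}) ≃ Πʳ_v [U(J)(F_v), U(J)(𝒪_v)]`)
and the acting group presented as `W` through a surjection `ζ : W →* Πʳ_v [H_v, KH_v]` acting by
`𝓢.OmegaPi ∘ Πʳφ ∘ ζ` (e.g. `W = E¹(𝔸_{F,f})` through its own restricted-product decomposition): the `U(J)(𝔸_{F,f})`-action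
`TwistedCoinv.rep (χ ∘ ζ) 𝓢.Omega hcW` on `Coinv(Ω_Π ∘ Πʳφ ∘ ζ, χ ∘ ζ)` is irreducible under the hypotheses of
`omegaPi_centralCoinv_isIrreducible` (`TwistedCoinv.isIrreducible_rep_comp_iff_of_surjective`,
`….isIrreducible_rep_iff_of_comp_surjective_right`). [cite: Liu2021, Def. 4.11 (l. 2092–2096), App. D Lem. D.1 (l. 5227; (1) l. 5229 for non-vanishing); Flath1979, Theorem 2 / Example 2] -/
theorem omega_centralCoinv_isIrreducible
    (hc : ∀ (v : HeightOneSpectrum (𝓞 F)) (g : UnitaryGroup.localPi E c N J v) (h' : H v),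
      Commute (𝓢.omegaLoc v g) ((show Representation ℂ (H v) _ from (𝓢.omegaLoc v).comp (φ v)) h'))
    (hcomm : ∀ (g : Πʳ v : HeightOneSpectrum (𝓞 F), [UnitaryGroup.localPi E c N J v, UnitaryGroup.localInt E c N J v])
        (h' : Πʳ v, [H v, KH v]),
      Commute (𝓢.OmegaPi g)
        ((𝓢.OmegaPi.comp (RestrictedProduct.mapAlongMonoidHom H (fun v => UnitaryGroup.localPi E c N J v) id
          Filter.tendsto_id φ hφ)) h'))
    (χ : (Πʳ v, [H v, KH v]) →* ℂˣ)
    (hχ : ∀ g : Πʳ v, [H v, KH v], ((χ g : ℂˣ) : ℂ) = ∏ᶠ v, ((χloc v (g v) : ℂˣ) : ℂ))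
    (hχK : ∀ᶠ v in cofinite, ∀ g ∈ KH v, χloc v g = 1)
    {S₁ : Finset (HeightOneSpectrum (𝓞 F))}
    (hx₀N : ∀ v ∉ S₁,
      TwistedCoinv.mk (show Representation ℂ (H v) _ from (𝓢.omegaLoc v).comp (φ v)) (χloc v) (unitVec F (Fin N) v)
        ≠ 0)
    (hirr : ∀ v, (TwistedCoinv.rep (χloc v) (𝓢.omegaLoc v) (hc v)).IsIrreducible)
    (hadm : ∀ v, (TwistedCoinv.rep (χloc v) (𝓢.omegaLoc v) (hc v)).IsAdmissible)
    {W : Type*} [Group W] (ζ : W →* Πʳ v : HeightOneSpectrum (𝓞 F), [H v, KH v]) (hζ : Function.Surjective ζ)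
    (hcW : ∀ (g : UnitaryGroup.finAdelic F E c N J) (w : W),
      Commute (𝓢.Omega g)
        ((show Representation ℂ W _ from
          (𝓢.OmegaPi.comp (RestrictedProduct.mapAlongMonoidHom H (fun v => UnitaryGroup.localPi E c N J v) id
            Filter.tendsto_id φ hφ)).comp ζ) w)) :
    (TwistedCoinv.rep (χ.comp ζ) 𝓢.Omega hcW).IsIrreducible := by
  -- `U(J)(𝔸_{F,f})` acts through the isomorphism `finAdelicEquiv`, and `W` through the surjection `ζ`
  have h1 := 𝓢.omegaPi_centralCoinv_isIrreducible φ hφ hc hcomm χ hχ hχK hx₀N hirr hadm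
  have hcζ : ∀ (g : Πʳ v : HeightOneSpectrum (𝓞 F), [UnitaryGroup.localPi E c N J v, UnitaryGroup.localInt E c N J v])
      (w : W), Commute (𝓢.OmegaPi g)
        ((show Representation ℂ W _ from
          (𝓢.OmegaPi.comp (RestrictedProduct.mapAlongMonoidHom H (fun v => UnitaryGroup.localPi E c N J v) id
            Filter.tendsto_id φ hφ)).comp ζ) w) := fun g w => hcomm g (ζ w)
  have h2 : (TwistedCoinv.rep (χ.comp ζ) 𝓢.OmegaPi hcζ).IsIrreducible :=
    (TwistedCoinv.isIrreducible_rep_iff_of_comp_surjective_right _ χ ζ hζ 𝓢.OmegaPi hcomm hcζ).2 h1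
  exact (TwistedCoinv.isIrreducible_rep_comp_iff_of_surjective _ (χ.comp ζ) 𝓢.OmegaPi hcζ
    (UnitaryGroup.finAdelicEquiv F E c N J).toMulEquiv.toMonoidHom (UnitaryGroup.finAdelicEquiv F E c N J).surjective
    hcW).2 h2

end Literature.NumberTheory.GelbartRogawski1991.UnitaryDualPair.LocalSplitting.FinLocalSplittings

end
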